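/-
Copyright (c) 2026 the pub-hodgecm-mathlib formalisation cell (harness21).  Prover seat hodgecm-mathlib-F0P3-p01 (g31), «(D-RAM) FOUR-FRAME» road of crux H413, line LH4,
unit U3_Laws, κ-STAGE B brick κG₂ «G₁-κ» (dealer LH4-plan (g11) WORD #52 (a); letter LH4-p09 (g3) `LETTER-kappaBG-tv2.v1` §1 (ρ = 0), κ owner LH4-p05 (g3)).
FILE κG₂-A2₀ — THE κ-COUNT OF A ROOT-GLUED TYPE-2 LATTICE (ρ = 0), COSET BY COSET.  2026-09-04.
-/
import Summits.HodgeConjecture.HodgeConjecture.Theorems.F0P3cDyRamDiagonalKappaGluedClassTwo                    -- ★ κG₂-A2 part 1 (this seat): brings ★ κG-A2 (`chiVec_zero_eq_one_of_window`), ★ NormSignConductor, ★ TraceBound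
import Summits.HodgeConjecture.HodgeConjecture.Theorems.F0P3cDyRamDiagonalGluedZeroPolarisationCountTypeTwo    -- ★ G2-C2 p856550 (LH4-p08 (g3)): brings ★ G2-C1 (explicit family, class criterion at ρ = 0), ★ G2-B (`coset_eq_of_exists`), ★ p856296
import HarnessLib

/-!
# Crux `H413`, κ-STAGE B brick κG₂, FILE A2₀: `kappaCount σ ϖ 2 i (latt W(y″, ζ))` on the root-glued type-2 stratum `(1, 1+2t, 1+2t)` — the `q − 1` cosets parametrised by the fixed classes of valuation `2t` modulo `𝔭^{2t+1}`

Cell `hodgecm-mathlib` (D-0151), FLOOR 0, crux item H413 = `stmt-HodgeConjecture-24833`; lane `--supports stmt-HodgeConjecture-24833 --as helper` (count-neutral).  THEOREMS ONLY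
(no `def`, no instance, no notation, no `sorry`).  Root-glued frame `W(y″, ζ) = (1 0 0; 0 1 0; y″ ζ ϖ^{1+2t})`, `|ζ| = 1`, `|y″| = |ϖ|^{2t}`, `t ≥ 1`.  By LH4-p08 (g3)'s ★ G2-C1 the
polarisation cosets of `latt W` are the fibres of the fixed invariant `r(D) = (D₀ + σy″·D₂·y″)∕D₂` (`|r| = |ϖ|^{2t}`) modulo `𝔭^{2t+1}`; the explicit family `D(α)` (★
`isVertexLattice_two_latt_glued_zero_explicit`) at `α_g := −(g·Nζ·P)⁻¹` has `r = −Ny″∕g`, `D₁ = −P·Nζ·(1+g)`, `D₀ = −Ny″·P·(1+g)∕g`, hence the SAME κ-letters as for `ρ ≥ 1`: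
`χ = (ω(−1)ω(1+g), ω(−1)ω(g)ω(1+g), ω(g))`; and `S_F(latt W) = {|u₂−u₁| ≤ |ϖ|^{1+2t}, |u₂−u₀| ≤ |ϖ|}` (★ p856296) gives the windows `2d ≤ 2t+2` (slot 0) ∕ `2d ≤ 2` (slots 1, 2) —
the `ρ = 0` instances of ★ κG₂-A2's `2d ≤ ρ+2t+2` ∕ `2d ≤ ρ+2`.  So for any complete irredundant finite system `S` of the fixed `g` with `|g| = |ϖ|^{2t}` modulo `𝔭^{2t+1}`
(`#S = q − 1`): HEAD **`kappaCount_two_latt_glued_zero_rep`**: `kappaCount σ ϖ 2 i (latt W) = Σ_{g ∈ S} (![ [2d ≤ 2t+2]·ω(−1)ω(1+g), [2d ≤ 2]·ω(−1)ω(g)ω(1+g), [2d ≤ 2]·ω(g) ] i)`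
(independent of `y″, ζ`: the κ-count is constant on the stratum).  Summed by ★ κG₂-B `sum_bracket_two_level` at `ρ = 0` it is the letter's `ω(−1)((q−1)[d ≤ t] − [t+1 = d])`, `0`, `0`.
HONEST LABEL.  Count-neutral (`--supports`); the κ-laws stay PROVER TARGETS; `HC_CM` is proved only modulo the 7 printed citations (2 remaining named inputs: hLiu418 =
`stmt-HodgeConjecture-24832`, h413 = `stmt-HodgeConjecture-24833`) until rung 0 closes.

## References
* [Kottwitz1986BaseChangeUnits] R. E. Kottwitz, *Base change for unit elements of Hecke algebras*, Compositio Math. 60 (1986), §1 pp. 240–241 (fixed-lattice counts via torus orbits).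
* [LanglandsShelstad1987] R. P. Langlands, D. Shelstad, *On the definition of transfer factors*, Math. Ann. 278 (1987), §3 (the κ-signs).
* [Serre1979] J.-P. Serre, *Local Fields*, GTM 67 (1979), Ch. V §3 Prop. 5, Cor. 3; Ch. XV §2.
-/

set_option autoImplicit false

noncomputable section

namespace Summit.HodgeConjecture.HodgeConjecture.Cruxes.H413.F0P3cDyRamDiagonalKappaGluedClassTwoZero

open Matrix
open Literature.NumberTheory.Automorphic Literature.NumberTheory.Automorphic.HermitianLattice Literature.NumberTheory.Automorphic.UnitaryGroup
open Literature.NumberTheory.Automorphic.UnitaryLatticeTree Literature.NumberTheory.Automorphic.UnitaryThreeFourFrame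
open Literature.NumberTheory.LocalFields.WildQuadraticDatum
open Summit.HodgeConjecture.HodgeConjecture.Cruxes.H413.F0P3cDyRamDiagonalTorusDefs
open Summit.HodgeConjecture.HodgeConjecture.Cruxes.H413.F0P3cDyRamDiagonalStrataDefs
open Summit.HodgeConjecture.HodgeConjecture.Cruxes.H413.F0P3cDyRamDiagonalKappaCountDefs
open Summit.HodgeConjecture.HodgeConjecture.Cruxes.H413.F0P3cDyRamDiagonalKappaCountEval hiding normSign_mul_of_dichotomy
open Summit.HodgeConjecture.HodgeConjecture.Cruxes.H413.F0P3cDyRamFixedCountDiagonalModel (normSign_mul_norm)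
open Summit.HodgeConjecture.HodgeConjecture.Cruxes.H413.F0P3cDyRamStableSumSignClasses (normSign_eq_one_or)
open Summit.HodgeConjecture.HodgeConjecture.Cruxes.H413.F0P3cDyRamDiagonalKappaGluedClass (chiVec_zero_eq_one_of_window)
open Summit.HodgeConjecture.HodgeConjecture.Cruxes.H413.F0P3cDyRamDiagonalGluedRhoZero (mem_latticeStabilizer_latt_rhoZero_iff)
open Summit.HodgeConjecture.HodgeConjecture.Cruxes.H413.F0P3cDyRamDiagonalGluedZeroPolarisationClassesTypeTwo
  (isVertexLattice_two_latt_glued_zero_explicit structure_of_polarisation_zero exists_stabiliser_iff_v_ratio_sub_le_zero)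
open Summit.HodgeConjecture.HodgeConjecture.Cruxes.H413.F0P3cDyRamDiagonalGluedPolarisationCountTypeTwo (mem_coset_self coset_eq_of_exists)
open scoped Valued WithZero Matrix MatrixGroups

variable {K : Type} [Field K] [Valued K ℤᵐ⁰]

/-! ## §1  The fixed stabiliser of a root-glued lattice -/

/-- **`S_F(latt W(y″, ζ))`** (★ p856296 `mem_latticeStabilizer_latt_rhoZero_iff` at `c = 1+2t`, `s = 2t`): for `u ∈ 𝒰_F`, `u ∈ S_F ⟺ |u₂ − u₁| ≤ |ϖ|^{1+2t} ∧ |u₂ − u₀| ≤ |ϖ|`.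
[cite: Kottwitz1986BaseChangeUnits, §1 pp. 240–241] -/
theorem mem_fixedUnitStabilizer_rootGlued_iff {σ : K →+* K} {ϖ : K} (hϖ0 : ϖ ≠ 0) (t : ℕ) {ζ y'' : K} (hζ : Valued.v ζ = 1) (hy'' : Valued.v y'' = Valued.v ϖ ^ (2 * t))
    (V : GL (Fin 3) K) (hV : (V : Matrix (Fin 3) (Fin 3) K) = !![1, 0, 0; 0, 1, 0; y'', ζ, ϖ ^ (1 + 2 * t)])
    {u : Fin 3 → Kˣ} (hu : u ∈ fixedUnitTorus σ 3) :
    u ∈ fixedUnitStabilizer σ (latt (V : Matrix (Fin 3) (Fin 3) K)) ↔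
      Valued.v ((u 2 : K) - u 1) ≤ Valued.v ϖ ^ (1 + 2 * t) ∧ Valued.v ((u 2 : K) - u 0) ≤ Valued.v ϖ := by
  obtain ⟨hu1, hu2⟩ := (mem_fixedUnitTorus_iff σ u).1 hu
  have h := mem_latticeStabilizer_latt_rhoZero_iff hϖ0 (s := 2 * t) (c := 1 + 2 * t) (by omega) hζ hy'' V hV u hu1
  rw [mem_latticeStabilizer_iff, show 1 + 2 * t - 2 * t = 1 by omega, pow_one] at h
  rw [mem_fixedUnitStabilizer_iff]
  exact ⟨fun hS => h.1 hS.1, fun hv => ⟨h.2 hv, hu1, hu2⟩⟩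

section Alive

variable [CompleteSpace K] [Finite 𝓀[K]] {σ : K →+* K} {ϖ : K} {d t₂ : ℕ}

/-! ## §2  Windows, signs, killers at ρ = 0 -/

/-- **WINDOW `i = 1, 2` AT ρ = 0: `2d ≤ 2` ⟹ `χ_1, χ_2 ≡ 1` on `S_F(latt W)`** (`|u₀∕u₂ − 1| ≤ |ϖ|`, `|u₁∕u₂ − 1| ≤ |ϖ|^{1+2t}`, `2d − 1 ≤ 1`).
[cite: Serre1979, Ch. V §3 Prop. 5, Cor. 3] [cite: LanglandsShelstad1987, §3] -/
theorem chiVec_one_two_eq_one_of_window_zero (hD : IsRamifiedQuadraticDatum σ ϖ d t₂) {t : ℕ} (hwin : 2 * d ≤ 2)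
    {u : Fin 3 → Kˣ} (hu : u ∈ fixedUnitTorus σ 3)
    (hb : Valued.v ((u 2 : K) - u 1) ≤ Valued.v ϖ ^ (1 + 2 * t)) (hc : Valued.v ((u 2 : K) - u 0) ≤ Valued.v ϖ) :
    chiVec σ 1 (fun j => ((u j : Kˣ) : K)) = 1 ∧ chiVec σ 2 (fun j => ((u j : Kˣ) : K)) = 1 := by
  have hϖ := hD.2.2.1
  have hϖ0 : ϖ ≠ 0 := (Valuation.ne_zero_iff _).1 (by rw [hϖ]; exact WithZero.exp_ne_zero)
  have hϖ1 : Valued.v ϖ < 1 := by rw [hϖ, ← WithZero.exp_zero, WithZero.exp_lt_exp]; norm_num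
  obtain ⟨hu1, hu2⟩ := (mem_fixedUnitTorus_iff σ u).1 hu
  have h0 : ∀ j, ((u j : Kˣ) : K) ≠ 0 := fun j => (u j).ne_zero
  have hσa : σ ((u 1 : K) / u 2) = (u 1 : K) / u 2 := by rw [map_div₀, hu2, hu2]
  have ha1 : Valued.v ((u 1 : K) / u 2 - 1) ≤ Valued.v ϖ ^ 1 := by
    rw [div_sub_one (h0 2), map_div₀, hu1 2, div_one, show ((u 1 : K)) - u 2 = -(((u 2 : K)) - u 1) by ring, Valuation.map_neg]
    refine hb.trans ?_
    rw [pow_add, pow_one]; exact mul_le_of_le_one_right zero_le (pow_le_one₀ zero_le hϖ1.le)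
  have hσb : σ ((u 0 : K) / u 2) = (u 0 : K) / u 2 := by rw [map_div₀, hu2, hu2]
  have hb1 : Valued.v ((u 0 : K) / u 2 - 1) ≤ Valued.v ϖ ^ 1 := by
    rw [div_sub_one (h0 2), map_div₀, hu1 2, div_one, show ((u 0 : K)) - u 2 = -(((u 2 : K)) - u 0) by ring, Valuation.map_neg, pow_one]; exact hc
  have hωa : normSign σ ((u 1 : K) / u 2) = 1 := normSign_eq_one_of_fixed_of_v_sub_one_le hD hσa (n := 1) (by omega) ha1
  have hωb : normSign σ ((u 0 : K) / u 2) = 1 := normSign_eq_one_of_fixed_of_v_sub_one_le hD hσb (n := 1) (by omega) hb1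
  have hN2 : ∀ x : K, normSign σ (x * ((u 2 : K) * (u 2 : K))) = normSign σ x := fun x => by
    nth_rw 2 [← hu2 2]; exact normSign_mul_norm σ x (h0 2)
  have e1 : ((u 0 : K)) * (u 2 : K) = ((u 0 : K) / u 2) * ((u 2 : K) * (u 2 : K)) := by field_simp
  have e2 : ((u 0 : K)) * (u 1 : K) = (((u 0 : K) / u 2) * ((u 1 : K) / u 2)) * ((u 2 : K) * (u 2 : K)) := by field_simp
  have hdiv0 : ∀ j, (u j : K) / u 2 ≠ 0 := fun j => div_ne_zero (h0 j) (h0 2)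
  rw [chiVec_eq, chiVec_eq]
  simp only [Fin.isValue, Matrix.cons_val_one, Matrix.cons_val_zero, Matrix.cons_val_two, Matrix.head_cons, Matrix.tail_cons]
  refine ⟨?_, ?_⟩
  · rw [← normSign_mul_of_fixed hD (hu2 0) (hu2 2) (h0 0) (h0 2), e1, hN2, hωb]
  · rw [← normSign_mul_of_fixed hD (hu2 0) (hu2 1) (h0 0) (h0 1), e2, hN2, normSign_mul_of_fixed hD hσb hσa (hdiv0 0) (hdiv0 1), hωa, hωb, mul_one]

/-- **THE SIGNS OF THE ρ = 0 SECTION**: for `g` fixed non-zero with `1 + g ≠ 0` and non-zero norms `Nζ`, `Ny″`, the form with `D₂ = P = ((ϖσϖ)^t)⁻¹`,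
`D₁ = α⁻¹ − P·Nζ`, `D₀ = Ny″·P·(α·Nζ·P − 1)` at `α = −(g·Nζ·P)⁻¹` has `χ = (ω(−1)ω(1+g), ω(−1)ω(g)ω(1+g), ω(g))`. [cite: LanglandsShelstad1987, §3] [cite: Serre1979, Ch. V §3] -/
theorem chiVec_section_zero (hD : IsRamifiedQuadraticDatum σ ϖ d t₂) (t : ℕ) {g ζ y'' : K} (hσg : σ g = g) (hg0 : g ≠ 0) (h1g : 1 + g ≠ 0) (hζ0 : ζ ≠ 0) (hy0 : y'' ≠ 0)
    (i : Fin 3) :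
    chiVec σ i (![σ y'' * y'' * (((ϖ * σ ϖ) ^ t)⁻¹) * ((-(g * (ζ * σ ζ) * (((ϖ * σ ϖ) ^ t)⁻¹))⁻¹) * (ζ * σ ζ) * (((ϖ * σ ϖ) ^ t)⁻¹) - 1),
        (-(g * (ζ * σ ζ) * (((ϖ * σ ϖ) ^ t)⁻¹))⁻¹)⁻¹ - (((ϖ * σ ϖ) ^ t)⁻¹) * (ζ * σ ζ), (((ϖ * σ ϖ) ^ t)⁻¹)] : Fin 3 → K) =
      (![normSign σ (-1) * normSign σ (1 + g), normSign σ (-1) * normSign σ g * normSign σ (1 + g), normSign σ g] : Fin 3 → ℤ) i := by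
  obtain ⟨hσ, -, hϖ, -⟩ := id hD
  have hϖ0 : ϖ ≠ 0 := (Valuation.ne_zero_iff _).1 (by rw [hϖ]; exact WithZero.exp_ne_zero)
  have hσϖ0 : σ ϖ ≠ 0 := fun h => hϖ0 (by rw [← hσ ϖ, h, map_zero])
  set P : K := ((ϖ * σ ϖ) ^ t)⁻¹ with hP
  have hP0 : P ≠ 0 := by rw [hP]; exact inv_ne_zero (pow_ne_zero _ (mul_ne_zero hϖ0 hσϖ0))
  have hσP : σ P = P := by rw [hP, map_inv₀, map_pow, map_mul, hσ, mul_comm (σ ϖ)]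
  have hωP : normSign σ P = 1 := by
    refine normSign_of_isNorm σ ⟨(ϖ ^ t)⁻¹, ?_⟩
    rw [hP, map_inv₀, map_pow, ← mul_inv, ← mul_pow]
  have hσζ0 : σ ζ ≠ 0 := fun h => hζ0 (by rw [← hσ ζ, h, map_zero])
  have hσy0 : σ y'' ≠ 0 := fun h => hy0 (by rw [← hσ y'', h, map_zero])
  have hNζ0 : ζ * σ ζ ≠ 0 := mul_ne_zero hζ0 hσζ0
  have hNy0 : σ y'' * y'' ≠ 0 := mul_ne_zero hσy0 hy0
  have hσNζ : σ (ζ * σ ζ) = ζ * σ ζ := by rw [map_mul, hσ, mul_comm]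
  have hσNy : σ (σ y'' * y'') = σ y'' * y'' := by rw [map_mul, hσ, mul_comm]
  have hωNζ : normSign σ (ζ * σ ζ) = 1 := normSign_of_isNorm σ ⟨ζ, rfl⟩
  have hωNy : normSign σ (σ y'' * y'') = 1 := normSign_of_isNorm σ ⟨y'', by rw [mul_comm]⟩
  -- the entries
  have hD1 : (-(g * (ζ * σ ζ) * P)⁻¹)⁻¹ - P * (ζ * σ ζ) = -(P * (ζ * σ ζ) * (1 + g)) := by rw [inv_neg, inv_inv]; ring
  have hD0 : σ y'' * y'' * P * (-(g * (ζ * σ ζ) * P)⁻¹ * (ζ * σ ζ) * P - 1) = -((σ y'' * y'') * P * (1 + g) * g⁻¹) := by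
    field_simp
    ring
  have hσ1g : σ (1 + g) = 1 + g := by rw [map_add, map_one, hσg]
  have hσm1 : σ (-1 : K) = -1 := by rw [map_neg, map_one]
  have hσgi : σ g⁻¹ = g⁻¹ := by rw [map_inv₀, hσg]
  have hgi0 : g⁻¹ ≠ 0 := inv_ne_zero hg0
  have hωgi : normSign σ g⁻¹ = normSign σ g := normSign_inv_of_map_eq σ hσg hg0
  have hω1 : normSign σ (-(P * (ζ * σ ζ) * (1 + g))) = normSign σ (-1) * normSign σ (1 + g) := by
    rw [show -(P * (ζ * σ ζ) * (1 + g)) = (-1) * ((P * (ζ * σ ζ)) * (1 + g)) by ring,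
      normSign_mul_of_fixed hD hσm1 (by rw [map_mul, map_mul, hσP, hσNζ, hσ1g]) (by norm_num) (mul_ne_zero (mul_ne_zero hP0 hNζ0) h1g),
      normSign_mul_of_fixed hD (by rw [map_mul, hσP, hσNζ]) hσ1g (mul_ne_zero hP0 hNζ0) h1g,
      normSign_mul_of_fixed hD hσP hσNζ hP0 hNζ0, hωP, hωNζ, one_mul, one_mul]
  have hω0 : normSign σ (-((σ y'' * y'') * P * (1 + g) * g⁻¹)) = normSign σ (-1) * normSign σ (1 + g) * normSign σ g := by
    rw [show -((σ y'' * y'') * P * (1 + g) * g⁻¹) = (-1) * (((σ y'' * y'') * P) * ((1 + g) * g⁻¹)) by ring,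
      normSign_mul_of_fixed hD hσm1 (by rw [map_mul, map_mul, hσNy, hσP, map_mul, hσ1g, hσgi]) (by norm_num)
        (mul_ne_zero (mul_ne_zero hNy0 hP0) (mul_ne_zero h1g hgi0)),
      normSign_mul_of_fixed hD (by rw [map_mul, hσNy, hσP]) (by rw [map_mul, hσ1g, hσgi]) (mul_ne_zero hNy0 hP0) (mul_ne_zero h1g hgi0),
      normSign_mul_of_fixed hD hσNy hσP hNy0 hP0, normSign_mul_of_fixed hD hσ1g hσgi h1g hgi0, hωP, hωNy, hωgi, one_mul, one_mul, mul_assoc]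
  have hsq : ∀ x : K, normSign σ x * normSign σ x = 1 := fun x => by rcases normSign_eq_one_or σ x with h | h <;> rw [h] <;> norm_num
  rw [chiVec_eq]
  fin_cases i
  · simp only [Fin.zero_eta, Fin.isValue, Matrix.cons_val_zero, Matrix.cons_val_one, Matrix.cons_val_two, Matrix.head_cons, Matrix.tail_cons]
    rw [hD1, hω1, hωP, mul_one]
  · simp only [Fin.mk_one, Fin.isValue, Matrix.cons_val_zero, Matrix.cons_val_one, Matrix.cons_val_two, Matrix.head_cons, Matrix.tail_cons]
    rw [hD0, hω0, hωP, mul_one]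
    ring
  · simp only [Fin.reduceFinMk, Fin.isValue, Matrix.cons_val_zero, Matrix.cons_val_one, Matrix.cons_val_two, Matrix.head_cons, Matrix.tail_cons]
    rw [hD0, hD1, hω0, hω1]
    have h1 := hsq (-1 : K)
    have h2 := hsq (1 + g)
    linear_combination (normSign σ g * (normSign σ (-1) * normSign σ (-1))) * h2 + normSign σ g * h1

open Classical in
/-- **THE ALIVE PREDICATE OF `S_F(latt W)` AT ρ = 0 IS THE WINDOW**: slot 0 `⟺ 2d ≤ 2t+2`, slots 1, 2 `⟺ 2d ≤ 2` (deep norms above; the level-`(d−1)` non-norm `n₀` gives the killers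
`(1, n₀, 1)` resp. `(n₀, 1, 1)` below). [cite: Serre1979, Ch. V §3 Prop. 5, Cor. 3] [cite: LanglandsShelstad1987, §3] -/
theorem forall_chiVec_eq_one_iff_window_zero (hD : IsRamifiedQuadraticDatum σ ϖ d t₂) (h2 : Valued.v (2 : K) < 1) (t : ℕ)
    {ζ y'' : K} (hζ : Valued.v ζ = 1) (hy'' : Valued.v y'' = Valued.v ϖ ^ (2 * t)) (V : GL (Fin 3) K)
    (hV : (V : Matrix (Fin 3) (Fin 3) K) = !![1, 0, 0; 0, 1, 0; y'', ζ, ϖ ^ (1 + 2 * t)]) (i : Fin 3) :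
    (∀ u ∈ fixedUnitStabilizer σ (latt (V : Matrix (Fin 3) (Fin 3) K)), chiVec σ i (fun j => ((u j : Kˣ) : K)) = 1) ↔
      (![2 * d ≤ 2 * t + 2, 2 * d ≤ 2, 2 * d ≤ 2] : Fin 3 → Prop) i := by
  obtain ⟨hσ, hvσ, hϖ, hfix, hdd, hd1, -⟩ := id hD
  have hϖ0 : ϖ ≠ 0 := (Valuation.ne_zero_iff _).1 (by rw [hϖ]; exact WithZero.exp_ne_zero)
  have hϖ1 : Valued.v ϖ < 1 := by rw [hϖ, ← WithZero.exp_zero, WithZero.exp_lt_exp]; norm_num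
  obtain ⟨n₀, hσn₀, hn₀1, hn₀d, hn₀n⟩ := exists_fixed_unit_not_norm_v_sub_one_le hD h2
  have hn₀d' : Valued.v (n₀ - 1) ≤ Valued.v ϖ ^ (2 * (d - 1)) := by
    rw [v_varpi_pow hϖ]; convert hn₀d using 2; push_cast; ring
  have hn₀0 : n₀ ≠ 0 := fun h => by rw [h, map_zero] at hn₀1; exact zero_ne_one hn₀1
  -- the two killers
  let u0 : Fin 3 → Kˣ := ![1, Units.mk0 n₀ hn₀0, 1]
  let u1 : Fin 3 → Kˣ := ![Units.mk0 n₀ hn₀0, 1, 1]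
  have hu0 : u0 ∈ fixedUnitTorus σ 3 := by
    rw [mem_fixedUnitTorus_iff]
    refine ⟨fun j => ?_, fun j => ?_⟩ <;> fin_cases j
    · exact map_one _
    · exact hn₀1
    · exact map_one _
    · exact map_one _
    · exact hσn₀
    · exact map_one _
  have hu1 : u1 ∈ fixedUnitTorus σ 3 := by
    rw [mem_fixedUnitTorus_iff]
    refine ⟨fun j => ?_, fun j => ?_⟩ <;> fin_cases j
    · exact hn₀1
    · exact map_one _
    · exact map_one _
    · exact hσn₀
    · exact map_one _
    · exact map_one _
  have hu0v : ((u0 0 : Kˣ) : K) = 1 ∧ ((u0 1 : Kˣ) : K) = n₀ ∧ ((u0 2 : Kˣ) : K) = 1 := ⟨rfl, rfl, rfl⟩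
  have hu1v : ((u1 0 : Kˣ) : K) = n₀ ∧ ((u1 1 : Kˣ) : K) = 1 ∧ ((u1 2 : Kˣ) : K) = 1 := ⟨rfl, rfl, rfl⟩
  have hχ0 : chiVec σ 0 (fun j => ((u0 j : Kˣ) : K)) ≠ 1 := by
    rw [chiVec_eq]; simp only [Fin.isValue, Matrix.cons_val_zero, hu0v.2.1, hu0v.2.2, normSign_one σ, mul_one, normSign_of_not_isNorm σ hn₀n]; decide
  have hχ1 : chiVec σ 1 (fun j => ((u1 j : Kˣ) : K)) ≠ 1 := by
    rw [chiVec_eq]; simp only [Fin.isValue, Matrix.cons_val_one, Matrix.cons_val_zero, hu1v.1, hu1v.2.2, normSign_one σ, mul_one, normSign_of_not_isNorm σ hn₀n]; decide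
  have hχ2 : chiVec σ 2 (fun j => ((u1 j : Kˣ) : K)) ≠ 1 := by
    rw [chiVec_eq]; simp only [Fin.isValue, Matrix.cons_val_two, Matrix.tail_cons, Matrix.head_cons, hu1v.1, hu1v.2.1, normSign_one σ, mul_one,
      normSign_of_not_isNorm σ hn₀n]; decide
  fin_cases i
  · simp only [Fin.zero_eta, Fin.isValue, Matrix.cons_val_zero]
    constructor
    · intro h
      by_contra hwin
      have hlev : Valued.v (n₀ - 1) ≤ Valued.v ϖ ^ (1 + 2 * t) := hn₀d'.trans (pow_le_pow_right_of_le_one' hϖ1.le (by omega))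
      have hmem : u0 ∈ fixedUnitStabilizer σ (latt (V : Matrix (Fin 3) (Fin 3) K)) := by
        refine (mem_fixedUnitStabilizer_rootGlued_iff hϖ0 t hζ hy'' V hV hu0).2 ⟨?_, ?_⟩
        · rw [hu0v.2.2, hu0v.2.1, show (1 : K) - n₀ = -(n₀ - 1) by ring, Valuation.map_neg]; exact hlev
        · rw [hu0v.2.2, hu0v.1, sub_self, map_zero]; exact zero_le
      exact hχ0 (h u0 hmem)
    · intro hwin u hu
      have hu𝒰 : u ∈ fixedUnitTorus σ 3 := ⟨((mem_fixedUnitStabilizer_iff σ _ u).1 hu).2.1, ((mem_fixedUnitStabilizer_iff σ _ u).1 hu).2.2⟩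
      have hb := ((mem_fixedUnitStabilizer_rootGlued_iff hϖ0 t hζ hy'' V hV hu𝒰).1 hu).1
      exact chiVec_zero_eq_one_of_window hD (ρ := 1) (t := t) (by omega) hu𝒰 hb
  · simp only [Fin.mk_one, Fin.isValue, Matrix.cons_val_one, Matrix.cons_val_zero]
    constructor
    · intro h
      by_contra hwin
      have hlev : Valued.v (n₀ - 1) ≤ Valued.v ϖ := by
        have h : Valued.v ϖ ^ (2 * (d - 1)) ≤ Valued.v ϖ ^ 1 := pow_le_pow_right_of_le_one' hϖ1.le (by omega)
        rw [pow_one] at h; exact hn₀d'.trans h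
      have hmem : u1 ∈ fixedUnitStabilizer σ (latt (V : Matrix (Fin 3) (Fin 3) K)) := by
        refine (mem_fixedUnitStabilizer_rootGlued_iff hϖ0 t hζ hy'' V hV hu1).2 ⟨?_, ?_⟩
        · rw [hu1v.2.2, hu1v.2.1, sub_self, map_zero]; exact zero_le
        · rw [hu1v.2.2, hu1v.1, show (1 : K) - n₀ = -(n₀ - 1) by ring, Valuation.map_neg]; exact hlev
      exact hχ1 (h u1 hmem)
    · intro hwin u hu
      have hu𝒰 : u ∈ fixedUnitTorus σ 3 := ⟨((mem_fixedUnitStabilizer_iff σ _ u).1 hu).2.1, ((mem_fixedUnitStabilizer_iff σ _ u).1 hu).2.2⟩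
      obtain ⟨hb, hc⟩ := (mem_fixedUnitStabilizer_rootGlued_iff hϖ0 t hζ hy'' V hV hu𝒰).1 hu
      exact (chiVec_one_two_eq_one_of_window_zero hD hwin hu𝒰 hb hc).1
  · simp only [Fin.reduceFinMk, Fin.isValue, Matrix.cons_val_two, Matrix.tail_cons, Matrix.head_cons]
    constructor
    · intro h
      by_contra hwin
      have hlev : Valued.v (n₀ - 1) ≤ Valued.v ϖ := by
        have h : Valued.v ϖ ^ (2 * (d - 1)) ≤ Valued.v ϖ ^ 1 := pow_le_pow_right_of_le_one' hϖ1.le (by omega)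
        rw [pow_one] at h; exact hn₀d'.trans h
      have hmem : u1 ∈ fixedUnitStabilizer σ (latt (V : Matrix (Fin 3) (Fin 3) K)) := by
        refine (mem_fixedUnitStabilizer_rootGlued_iff hϖ0 t hζ hy'' V hV hu1).2 ⟨?_, ?_⟩
        · rw [hu1v.2.2, hu1v.2.1, sub_self, map_zero]; exact zero_le
        · rw [hu1v.2.2, hu1v.1, show (1 : K) - n₀ = -(n₀ - 1) by ring, Valuation.map_neg]; exact hlev
      exact hχ2 (h u1 hmem)
    · intro hwin u hu
      have hu𝒰 : u ∈ fixedUnitTorus σ 3 := ⟨((mem_fixedUnitStabilizer_iff σ _ u).1 hu).2.1, ((mem_fixedUnitStabilizer_iff σ _ u).1 hu).2.2⟩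
      obtain ⟨hb, hc⟩ := (mem_fixedUnitStabilizer_rootGlued_iff hϖ0 t hζ hy'' V hV hu𝒰).1 hu
      exact (chiVec_one_two_eq_one_of_window_zero hD hwin hu𝒰 hb hc).2

end Alive

end Summit.HodgeConjecture.HodgeConjecture.Cruxes.H413.F0P3cDyRamDiagonalKappaGluedClassTwoZero

end
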